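import Literature.Probability.FitznerVanDerHofstad2017.NobleBoundsNAssemblyStar
import Literature.Probability.FitznerVanDerHofstad2017.NobleBlocksCovClosed
import HarnessLib

/-!
# [FvdH17] Prop. 5.5 (5.34) at every `N ≥ 2` over `Fin 3 ⊕ Unit` with the AVERAGED terminal element (p. 59)

R. Fitzner and R. van der Hofstad, *Mean-field behavior for nearest-neighbor percolation in `d > 10`*,
Electron. J. Probab. **22** (2017) no. 43; arXiv:1506.07977v2 — §5.1 (5.4), "Elements of the bounds" (pp. 48–49),
Prop. 5.5 (5.34) (p. 53), §6.1 (6.4)–(6.5) and p. 59 ("we include the information that … u and w are neighbors"),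
§6.2.1 (6.48)–(6.49), Lemma 6.1 (pp. 65–67), §3.5 (symmetry of the model, p. 32).

## What this module is

The companion of `NobleBoundsNAssemblyStar` with the p. 59 AVERAGED terminal element in the regular block
(`matAbarAvg (unitVecs d) … (blockAbar' 𝐋)` instead of the printed double-sup `matAbar`), i.e. the same element the
`Fin 3` consumer `tsum_nobleXiT_le_of_cover` (module `NobleBoundsNAssembly`) uses:
* §A (generic `G ι K`, symmetry set `Φ`): covariance notions `IsCov₃`, `IsCov₆`; inheritance of `Φ`-covariance by
  the extended families (`isCov₂_starS`, `isCov₄_sum_starB`) and by the `κ`-summed SECTION families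
  (`isCov₄_sum_secEo`, `isCov₃_sum_secEc`, `isCov₃_sum_secEoc`); the support hypotheses `hAin`/`hAout` and the
  flank constancy of the extended families (`starA_hAin`, `starA_hAout`, `starS_gapConst`); the abstract chain
  bound `tsum_le_star_chain_avg'` ((6.4) exit order, averaged element over `ι ⊕ Unit`, class `★` never averaged);
  the entrywise comparison `matAbarAvg_starA_sec_le` of the averaged extended terminal matrix (section choice)
  with the bordered averaged printed one.
* §B (bond percolation on `ℤ^d`): `W_d`-covariance of the POINTWISE middle block — `perc_blockBNTpt₀_signedPerm`,
  `perc_blockBNTpt_signedPerm`, `perc_blockBpt_signedPerm`, `perc_blockBFullpt_signedPerm`,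
  `sum_perc_blockBFullpt_signedPerm`, `isCov₆_sum_perc_blockBFullpt`.
* §C: the assemblies `tsum_nobleXiT_le_starAvg_of_cover` (arbitrary special families, with their summation,
  translation, covariance and out-support hypotheses), `tsum_nobleXiT_le_secStarAvg_of_cover` (section choice
  `a₂ = 2`, `a₀ = 0`: every side condition discharged) and `tsum_nobleXiT_le_borderedAvg_of_cover`
  (`≤ (P⃗^S,0) · [[B, B_{·,0}],[B_{2,·}, B_{2,0}]]^n · [[Ā'_avg, 0],[Ā'_{2,·}, 0]] · (P⃗^E,0)`).

No percolation estimate is proved here; nothing is cited as a fact; ADDITIVE module; `d`-generic.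
-/

noncomputable section

open scoped BigOperators ENNReal Matrix

/-! ## §A. Covariance and the averaged chain bound over `ι ⊕ Unit` (generic) -/

namespace Literature.Probability.FitznerVanDerHofstad2017.BlockSummation

variable {G ι K : Type*}

section Cov

variable [AddCommGroup G] (Φ : Set (G ≃+ G))

/-- Covariance of a three-point kernel under `Φ`. [folklore] -/
def IsCov₃ (M : G → G → G → ℝ≥0∞) : Prop := ∀ φ ∈ Φ, ∀ u w y, M (φ u) (φ w) (φ y) = M u w y

/-- Covariance of a six-point kernel under `Φ`. [folklore] -/
def IsCov₆ (M : G → G → G → G → G → G → ℝ≥0∞) : Prop :=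
  ∀ φ ∈ Φ, ∀ u w t z x y, M (φ u) (φ w) (φ t) (φ z) (φ x) (φ y) = M u w t z x y

variable {Φ}

/-- The extended start family is covariant if the regular one is. [folklore] -/
theorem isCov₂_starS {S : ι → G → G → ℝ≥0∞} (hS : ∀ a, IsCov₂ Φ (S a)) : ∀ x, IsCov₂ Φ (starS S x)
  | Sum.inl a => hS a
  | Sum.inr _ => fun _ _ _ _ => rfl

/-- **The `κ`-summed extended middle family is covariant** if the `κ`-summed regular, closed, pinned and
pinned-closed families are (the Kroneckers `𝟙{w' = u}` are invariant under the injective `φ`). [folklore] -/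
theorem isCov₄_sum_starB [Fintype K] [DecidableEq G] {B : K → ι → ι → G → G → G → G → ℝ≥0∞}
    {Ec : K → ι → G → G → G → ℝ≥0∞} {Eo : K → ι → G → G → G → G → ℝ≥0∞} {Eoc : K → G → G → G → ℝ≥0∞}
    (hB : ∀ a a', IsCov₄ Φ (fun u w w' u' => ∑ κ, B κ a a' u w w' u'))
    (hEc : ∀ a, IsCov₃ Φ (fun u w u' => ∑ κ, Ec κ a u w u'))
    (hEo : ∀ a', IsCov₄ Φ (fun u w w' u' => ∑ κ, Eo κ a' u w w' u'))
    (hEoc : IsCov₃ Φ (fun u w u' => ∑ κ, Eoc κ u w u')) :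
    ∀ x y, IsCov₄ Φ (fun u w w' u' => ∑ κ, starB B Ec Eo Eoc κ x y u w w' u')
  | Sum.inl a, Sum.inl a' => hB a a'
  | Sum.inl a, Sum.inr _ => by
      intro φ hφ u w w' u'
      by_cases h : w' = u
      · subst h
        simp only [starB_inl_inr, if_true]
        exact hEc a φ hφ _ _ _
      · have h' : φ w' ≠ φ u := fun e => h (φ.injective e)
        simp only [starB_inl_inr, if_neg h, if_neg h', Finset.sum_const_zero]
  | Sum.inr _, Sum.inl a' => hEo a'
  | Sum.inr _, Sum.inr _ => by
      intro φ hφ u w w' u'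
      by_cases h : w' = u
      · subst h
        simp only [starB_inr_inr, if_true]
        exact hEoc φ hφ _ _ _
      · have h' : φ w' ≠ φ u := fun e => h (φ.injective e)
        simp only [starB_inr_inr, if_neg h, if_neg h', Finset.sum_const_zero]

/-- **Covariance of the `κ`-summed pinned section** from six-point covariance of the `κ`-summed pointwise block.
[folklore] -/
theorem isCov₄_sum_secEo [Fintype K] {Bpt : K → ι → ι → G → G → G → G → G → G → ℝ≥0∞}
    (hBpt : ∀ a a', IsCov₆ Φ (fun u w t z w' u' => ∑ κ, Bpt κ a a' u w t z w' u')) (a₂ a' : ι) :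
    IsCov₄ Φ (fun u w w' u' => ∑ κ, secEo Bpt a₂ κ a' u w w' u') := by
  intro φ hφ u w w' u'
  simp only [secEo, ← tsum_finsetSum]
  calc ∑' t, ∑ κ, Bpt κ a₂ a' (φ u) (φ w) t (φ w) (φ w') (φ u')
      = ∑' t, ∑ κ, Bpt κ a₂ a' (φ u) (φ w) (φ t) (φ w) (φ w') (φ u') :=
        (Equiv.tsum_eq φ.toEquiv (fun t => ∑ κ, Bpt κ a₂ a' (φ u) (φ w) t (φ w) (φ w') (φ u'))).symm
    _ = ∑' t, ∑ κ, Bpt κ a₂ a' u w t w w' u' := tsum_congr fun t => hBpt a₂ a' φ hφ u w t w w' u'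

/-- **Covariance of the `κ`-summed closed section**. [folklore] -/
theorem isCov₃_sum_secEc [Fintype K] {Bpt : K → ι → ι → G → G → G → G → G → G → ℝ≥0∞}
    (hBpt : ∀ a a', IsCov₆ Φ (fun u w t z w' u' => ∑ κ, Bpt κ a a' u w t z w' u')) (a₀ a : ι) :
    IsCov₃ Φ (fun u w u' => ∑ κ, secEc Bpt a₀ κ a u w u') := by
  intro φ hφ u w u'
  simp only [secEc, ← tsum_finsetSum]
  calc ∑' t, ∑' z, ∑ κ, Bpt κ a a₀ (φ u) (φ w) t z (φ u') (φ u')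
      = ∑' t, ∑' z, ∑ κ, Bpt κ a a₀ (φ u) (φ w) (φ t) z (φ u') (φ u') :=
        (Equiv.tsum_eq φ.toEquiv (fun t => ∑' z, ∑ κ, Bpt κ a a₀ (φ u) (φ w) t z (φ u') (φ u'))).symm
    _ = ∑' t, ∑' z, ∑ κ, Bpt κ a a₀ (φ u) (φ w) (φ t) (φ z) (φ u') (φ u') := tsum_congr fun t =>
        (Equiv.tsum_eq φ.toEquiv (fun z => ∑ κ, Bpt κ a a₀ (φ u) (φ w) (φ t) z (φ u') (φ u'))).symm
    _ = ∑' t, ∑' z, ∑ κ, Bpt κ a a₀ u w t z u' u' :=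
        tsum_congr fun t => tsum_congr fun z => hBpt a a₀ φ hφ u w t z u' u'

/-- **Covariance of the `κ`-summed pinned-and-closed section**. [folklore] -/
theorem isCov₃_sum_secEoc [Fintype K] {Bpt : K → ι → ι → G → G → G → G → G → G → ℝ≥0∞}
    (hBpt : ∀ a a', IsCov₆ Φ (fun u w t z w' u' => ∑ κ, Bpt κ a a' u w t z w' u')) (a₂ a₀ : ι) :
    IsCov₃ Φ (fun u w u' => ∑ κ, secEoc Bpt a₂ a₀ κ u w u') := by
  intro φ hφ u w u'
  simp only [secEoc, ← tsum_finsetSum]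
  calc ∑' t, ∑ κ, Bpt κ a₂ a₀ (φ u) (φ w) t (φ w) (φ u') (φ u')
      = ∑' t, ∑ κ, Bpt κ a₂ a₀ (φ u) (φ w) (φ t) (φ w) (φ u') (φ u') :=
        (Equiv.tsum_eq φ.toEquiv (fun t => ∑ κ, Bpt κ a₂ a₀ (φ u) (φ w) t (φ w) (φ u') (φ u'))).symm
    _ = ∑' t, ∑ κ, Bpt κ a₂ a₀ u w t w u' u' := tsum_congr fun t => hBpt a₂ a₀ φ hφ u w t w u' u'

end Cov

section Avg

variable [AddCommGroup G] [DecidableEq G]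

/-- **In-support of the extended terminal family**: if the regular family vanishes off `U` on the in-gap for the
averaged in-classes, so does `starA` (class `★` is never averaged). [folklore] -/
theorem starA_hAin {U : Finset G} {avg : ι → Bool} {A : K → ι → ι → G → G → G → G → ℝ≥0∞}
    {EA : K → ι → G → G → G → ℝ≥0∞} (hAin : ∀ κ a b, avg a = true → ∀ v x y, v ∉ U → A κ a b 0 v x y = 0) :
    ∀ κ (a b : ι ⊕ Unit), Sum.elim avg (fun _ => false) a = true → ∀ v x y, v ∉ U → starA A EA κ a b 0 v x y = 0
  | κ, Sum.inl a, Sum.inl b, ha, v, x, y, hv => hAin κ a b ha v x y hv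
  | κ, Sum.inl a, Sum.inr _, _, v, x, y, _ => rfl
  | κ, Sum.inr _, b, ha, v, x, y, _ => absurd ha (by simp)

/-- **Out-support of the extended terminal family**: if the regular family vanishes off `U` on the out-gap for
the averaged out-classes and the pinned terminal family does too (`EA^{κ,c}(0,v,x) = 0` for `v − x ∉ U`), so does
`starA`. [folklore] -/
theorem starA_hAout {U : Finset G} {avg : ι → Bool} {A : K → ι → ι → G → G → G → G → ℝ≥0∞}
    {EA : K → ι → G → G → G → ℝ≥0∞} (hAout : ∀ κ a b, avg b = true → ∀ v x y, y - x ∉ U → A κ a b 0 v x y = 0)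
    (hEAout : ∀ κ c, avg c = true → ∀ v x, v - x ∉ U → EA κ c 0 v x = 0) :
    ∀ κ (a b : ι ⊕ Unit), Sum.elim avg (fun _ => false) b = true → ∀ v x y, y - x ∉ U →
      starA A EA κ a b 0 v x y = 0
  | κ, Sum.inl a, Sum.inl b, hb, v, x, y, hxy => hAout κ a b hb v x y hxy
  | κ, Sum.inr _, Sum.inl c, hc, v, x, y, hxy => by
      by_cases h : y = v
      · subst h
        simp only [starA_inr_inl, if_true]
        exact hEAout κ c hc _ _ hxy
      · simp only [starA_inr_inl, if_neg h]
  | κ, a, Sum.inr _, hb, v, x, y, _ => absurd hb (by simp)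

omit [DecidableEq G] in
/-- Flank constancy of the extended exit family for the averaged classes. [folklore] -/
theorem starS_gapConst {U : Finset G} {avg : ι → Bool} {PE : ι → G → G → ℝ≥0∞}
    (hPE : ∀ b, avg b = true → IsConstOn U (gapSum (PE b))) :
    ∀ b : ι ⊕ Unit, Sum.elim avg (fun _ => false) b = true → IsConstOn U (gapSum (starS PE b))
  | Sum.inl b, hb => hPE b hb
  | Sum.inr _, hb => absurd hb (by simp)

/-- **(5.34) over `ι ⊕ Unit` with the AVERAGED terminal element, exit arguments ordered as in (6.4)**: from an
`x`-space bound against `recP (starS S) (starB …) M · starA A EA · starS PE` and (i) translation invariance of all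
families, (ii) the in-support and out-support of `A` (and of `EA` on the out-side) off `U` for the averaged classes,
(iii) `Φ`-covariance of `S` and of the `κ`-summed middle families with `Φ` transitive on `U`, (iv) flank constancy
of `PE`, conclude `Σ_x Ξ(x) ≤ (P⃗,0) · matB(starB)^M · matAbarAvg U avg' (starA A EA) · (P⃗^E,0)` with
`avg' = Sum.elim avg (fun _ => false)` (class `★` never averaged).
[cite: FitznerVanDerHofstad2017, Prop. 5.5 (5.34) (arXiv:1506.07977v2 p. 53); §6.1 (6.4)–(6.5) (p. 58), p. 59; §6.2.1 (6.48)–(6.49) (p. 65); §3.5 (p. 32)] -/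
theorem tsum_le_star_chain_avg' [Fintype ι] [DecidableEq ι] [Fintype K] (U : Finset G) (avg : ι → Bool)
    (Φ : Set (G ≃+ G)) (hT : ∀ v ∈ U, ∀ v' ∈ U, ∃ φ ∈ Φ, φ v = v')
    {B A : K → ι → ι → G → G → G → G → ℝ≥0∞} {S PE : ι → G → G → ℝ≥0∞}
    {Ec : K → ι → G → G → G → ℝ≥0∞} {Eo : K → ι → G → G → G → G → ℝ≥0∞} {Eoc : K → G → G → G → ℝ≥0∞}
    {EA : K → ι → G → G → G → ℝ≥0∞}
    (hB : ∀ κ a b, IsTransInv (B κ a b)) (hEc : ∀ κ a, IsTransInv₃ (Ec κ a)) (hEo : ∀ κ a', IsTransInv (Eo κ a'))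
    (hEoc : ∀ κ, IsTransInv₃ (Eoc κ)) (hA : ∀ κ a b, IsTransInv (A κ a b)) (hEA : ∀ κ c, IsTransInv₃ (EA κ c))
    (hAin : ∀ κ a b, avg a = true → ∀ v x y, v ∉ U → A κ a b 0 v x y = 0)
    (hAout : ∀ κ a b, avg b = true → ∀ v x y, y - x ∉ U → A κ a b 0 v x y = 0)
    (hEAout : ∀ κ c, avg c = true → ∀ v x, v - x ∉ U → EA κ c 0 v x = 0)
    (hS : ∀ a, IsCov₂ Φ (S a)) (hBc : ∀ a a', IsCov₄ Φ (fun u w w' u' => ∑ κ, B κ a a' u w w' u'))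
    (hEcc : ∀ a, IsCov₃ Φ (fun u w u' => ∑ κ, Ec κ a u w u'))
    (hEocv : ∀ a', IsCov₄ Φ (fun u w w' u' => ∑ κ, Eo κ a' u w w' u'))
    (hEocc : IsCov₃ Φ (fun u w u' => ∑ κ, Eoc κ u w u'))
    (hPE : ∀ b, avg b = true → IsConstOn U (gapSum (PE b))) (Ξ : G → ℝ≥0∞) (M : ℕ)
    (hΞ : ∀ x, Ξ x ≤ ∑' u, ∑' w, ∑' t, ∑' z, ∑ κ, ∑ a : ι ⊕ Unit, ∑ b : ι ⊕ Unit,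
      recP (starS S) (starB B Ec Eo Eoc) M a u w * starA A EA κ a b u w t z * starS PE b (t - x) (z - x)) :
    ∑' x, Ξ x ≤ vecP (starS S) ᵥ* matB (starB B Ec Eo Eoc) ^ M ᵥ*
      matAbarAvg U (Sum.elim avg fun _ => false) (starA A EA) ⬝ᵥ vecP (starS PE) :=
  tsum_le_vecMul_pow_dotProduct_avg' U (Sum.elim avg fun _ => false) (isTransInv_starB hB hEc hEo hEoc)
    (isTransInv_starA hA hEA) (starA_hAin hAin) (starA_hAout hAout hEAout) Ξ (starS S) (starS PE) M
    (fun a _ => isConstOn_gapSum_recP Φ U hT (starS S) (isCov₂_starS hS) (starB B Ec Eo Eoc)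
      (isCov₄_sum_starB hBc hEcc hEocv hEocc) M a)
    (starS_gapConst hPE) hΞ

/-- **Averaged extended terminal matrix under the section choice ≤ the bordered averaged printed one**,
entrywise: regular block `= matAbarAvg U avg A`, `★` column `0`, `★` row `≤ (matAbar A)_{a₂,·}`.
[cite: FitznerVanDerHofstad2017, §5.1 "Elements of the bounds" (arXiv:1506.07977v2 p. 49); §6.1 p. 59] -/
theorem matAbarAvg_starA_sec_le [Fintype K] (U : Finset G) (avg : ι → Bool)
    (A : K → ι → ι → G → G → G → G → ℝ≥0∞) (a₂ : ι) :
    ∀ i j, matAbarAvg U (Sum.elim avg fun _ => false) (starA A (secEA A a₂)) i j ≤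
      Matrix.fromBlocks (matAbarAvg U avg A) 0 (Matrix.of fun _ c => matAbar A a₂ c) 0 i j
  | Sum.inl a, Sum.inl c => by
      simp only [Matrix.fromBlocks_apply₁₁, matAbarAvg_apply, Sum.elim_inl, starA_inl_inl]; exact le_rfl
  | Sum.inl a, Sum.inr s => (matAbarAvg_le_matAbar U _ _ _ _).trans (by
      rw [matAbar_starA_inr_right, Matrix.fromBlocks_apply₁₂]; exact le_rfl)
  | Sum.inr s, Sum.inl c => (matAbarAvg_le_matAbar U _ _ _ _).trans (by
      rw [matAbar_starA_inr_inl, Matrix.fromBlocks_apply₂₁, Matrix.of_apply]; exact normEA_secEA_le A a₂ c)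
  | Sum.inr s, Sum.inr s' => (matAbarAvg_le_matAbar U _ _ _ _).trans (by
      rw [matAbar_starA_inr_right, Matrix.fromBlocks_apply₂₂]; exact le_rfl)

end Avg

end Literature.Probability.FitznerVanDerHofstad2017.BlockSummation

/-! ## §B. Bond percolation: `W_d`-covariance of the pointwise middle block -/

namespace Literature.Probability.FitznerVanDerHofstad2017.NobleBlocks

open Literature.Probability.LatticeModels Literature.Probability.Percolation
open Literature.Probability.FitznerVanDerHofstad2017.BlockSummation
open Literature.Barriers.CriticalPhenomena (signedPerm_sub signedPerm_neg)

variable {d : ℕ}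

section SignedPerm

variable (p : unitInterval) (π : Equiv.Perm (Fin d)) (ε : Fin d → ℤˣ) {ρ : Fin d × Bool → Fin d × Bool}

/-- **`B^{(2)}` summand covariance**: `blockBNTpt₀ 𝐋 (ρκ) a b (σv) (σx) (σy) (σt) (σz) = blockBNTpt₀ 𝐋 κ a b v x y t z`
when `σ e_κ = e_{ρκ}`. [cite: FitznerVanDerHofstad2017, App. B Table "Diagrams and definition of B^{(2),ι,a,b}(0,v,x,y)" (arXiv:1506.07977v2 p. 76); §3.5 (p. 32)] -/
theorem perc_blockBNTpt₀_signedPerm (hρ : ∀ κ, Site.signedPerm π ε (stepVec κ) = stepVec (ρ κ)) (κ : Fin d × Bool)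
    (a b : Fin 3) (v x y t z : Site d) :
    blockBNTpt₀ (Letters.perc d p) (ρ κ) a b (Site.signedPerm π ε v) (Site.signedPerm π ε x) (Site.signedPerm π ε y)
      (Site.signedPerm π ε t) (Site.signedPerm π ε z) = blockBNTpt₀ (Letters.perc d p) κ a b v x y t z := by
  fin_cases a <;> fin_cases b <;>
    simp only [blockBNTpt₀, ← hρ, kd_signedPerm_zero, kdc_signedPerm, ← signedPerm_sub, ← signedPerm_neg,
      twoDD_signedPerm, perc_S_signedPerm, perc_T_signedPerm_zero, perc_P_signedPerm, perc_B_signedPerm]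

/-- `blockBNTpt 𝐋 (ρκ) a a' (σ·) = blockBNTpt 𝐋 κ a a' (·)`. [cite: FitznerVanDerHofstad2017, App. B (arXiv:1506.07977v2 p. 76); §3.5 (p. 32)] -/
theorem perc_blockBNTpt_signedPerm (hρ : ∀ κ, Site.signedPerm π ε (stepVec κ) = stepVec (ρ κ)) (κ : Fin d × Bool)
    (a a' : Fin 3) (u w t z w' u' : Site d) :
    blockBNTpt (Letters.perc d p) (ρ κ) a a' (Site.signedPerm π ε u) (Site.signedPerm π ε w) (Site.signedPerm π ε t)
      (Site.signedPerm π ε z) (Site.signedPerm π ε w') (Site.signedPerm π ε u') =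
      blockBNTpt (Letters.perc d p) κ a a' u w t z w' u' := by
  simp only [blockBNTpt, ← signedPerm_sub, perc_blockBNTpt₀_signedPerm p π ε hρ]

/-- **Pointwise (5.4) covariance** for any covariant pointwise parameter `B2pt`.
[cite: FitznerVanDerHofstad2017, §5.1 (5.4) (arXiv:1506.07977v2 p. 48); §3.5 (p. 32)] -/
theorem perc_blockBpt_signedPerm {B2pt : DirBlockFamilyPt d} (hρ : ∀ κ, Site.signedPerm π ε (stepVec κ) = stepVec (ρ κ))
    (hB2 : ∀ κ a b u w t z w' u', B2pt (ρ κ) a b (Site.signedPerm π ε u) (Site.signedPerm π ε w)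
      (Site.signedPerm π ε t) (Site.signedPerm π ε z) (Site.signedPerm π ε w') (Site.signedPerm π ε u') =
      B2pt κ a b u w t z w' u') (κ : Fin d × Bool) (a b : Fin 3) (u w t z w' u' : Site d) :
    blockBpt (Letters.perc d p) B2pt (ρ κ) a b (Site.signedPerm π ε u) (Site.signedPerm π ε w) (Site.signedPerm π ε t)
      (Site.signedPerm π ε z) (Site.signedPerm π ε w') (Site.signedPerm π ε u') =
      blockBpt (Letters.perc d p) B2pt κ a b u w t z w' u' := by
  simp only [blockBpt, perc_blockAiotaSt_signedPerm p π ε hρ, perc_blockA_signedPerm p π ε, kd_signedPerm,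
    perc_blockAiota_signedPerm p π ε hρ, ← signedPerm_sub, perc_blockPS_signedPerm, hB2]

/-- **`blockBFullpt 𝐋 (ρκ) a b (σ·) = blockBFullpt 𝐋 κ a b (·)`** (pieces plugged in).
[cite: FitznerVanDerHofstad2017, §5.1 (5.4) (arXiv:1506.07977v2 p. 48); App. B (p. 76); §3.5 (p. 32)] -/
theorem perc_blockBFullpt_signedPerm (hρ : ∀ κ, Site.signedPerm π ε (stepVec κ) = stepVec (ρ κ)) (κ : Fin d × Bool)
    (a b : Fin 3) (u w t z w' u' : Site d) :
    blockBFullpt (Letters.perc d p) (ρ κ) a b (Site.signedPerm π ε u) (Site.signedPerm π ε w) (Site.signedPerm π ε t)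
      (Site.signedPerm π ε z) (Site.signedPerm π ε w') (Site.signedPerm π ε u') =
      blockBFullpt (Letters.perc d p) κ a b u w t z w' u' :=
  perc_blockBpt_signedPerm p π ε hρ (perc_blockBNTpt_signedPerm p π ε hρ) κ a b u w t z w' u'

/-- **`Σ_κ blockBFullpt 𝐋 κ a b (σ·) = Σ_κ blockBFullpt 𝐋 κ a b (·)`**. [cite: FitznerVanDerHofstad2017, §5.1 (5.4) (arXiv:1506.07977v2 p. 48); §6.1 p. 59; §3.5 (p. 32)] -/
theorem sum_perc_blockBFullpt_signedPerm (a b : Fin 3) (u w t z w' u' : Site d) :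
    ∑ κ, blockBFullpt (Letters.perc d p) κ a b (Site.signedPerm π ε u) (Site.signedPerm π ε w) (Site.signedPerm π ε t)
        (Site.signedPerm π ε z) (Site.signedPerm π ε w') (Site.signedPerm π ε u') =
      ∑ κ, blockBFullpt (Letters.perc d p) κ a b u w t z w' u' := by
  obtain ⟨σ, hσ⟩ := exists_stepVec_perm π ε
  rw [← Equiv.sum_comp σ (fun κ => blockBFullpt (Letters.perc d p) κ a b (Site.signedPerm π ε u)
    (Site.signedPerm π ε w) (Site.signedPerm π ε t) (Site.signedPerm π ε z) (Site.signedPerm π ε w')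
    (Site.signedPerm π ε u'))]
  exact Finset.sum_congr rfl fun κ _ => perc_blockBFullpt_signedPerm p π ε hσ κ a b u w t z w' u'

end SignedPerm

/-- **`Σ_κ blockBFullpt 𝐋 κ a b` is `W_d`-covariant in all six vertices** (hypothesis `hBpt` of
`isCov₄_sum_secEo` / `isCov₃_sum_secEc` / `isCov₃_sum_secEoc` for bond percolation).
[cite: FitznerVanDerHofstad2017, §5.1 (5.4) (arXiv:1506.07977v2 p. 48); §6.1 p. 59; §3.5 (p. 32)] -/
theorem isCov₆_sum_perc_blockBFullpt (p : unitInterval) (a b : Fin 3) :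
    IsCov₆ (signedPermAddEquivs d) (fun u w t z w' u' => ∑ κ, blockBFullpt (Letters.perc d p) κ a b u w t z w' u') := by
  rintro φ ⟨⟨π, ε⟩, rfl⟩ u w t z w' u'
  exact sum_perc_blockBFullpt_signedPerm p π ε a b u w t z w' u'

end Literature.Probability.FitznerVanDerHofstad2017.NobleBlocks

/-! ## §C. Bond percolation: the assemblies with the averaged element -/

namespace Literature.Probability.FitznerVanDerHofstad2017

open _root_.MeasureTheory Literature.Probability.LatticeModels Literature.Probability.Percolation
open Literature.Probability.FitznerVanDerHofstad2017.NobleBlocks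
open Literature.Probability.FitznerVanDerHofstad2017.BlockSummation
open Literature.Barriers.CriticalPhenomena

variable {d : ℕ}

section Perc

variable (p : unitInterval)

local notation "𝐋" => Letters.perc d p

/-- **Prop. 5.5 (5.34) at `N = n + 1` over `Fin 3 ⊕ Unit` with the AVERAGED terminal element, FROM THE
PERCOLATION ESTIMATES, for arbitrary special families** (with their summation, translation, `W_d`-covariance and
out-support hypotheses).
[cite: FitznerVanDerHofstad2017, Prop. 5.5 (5.34) (arXiv:1506.07977v2 p. 53); §5.1 (5.4), "Elements of the bounds" (pp. 48–49); §6.1 (6.4)–(6.5) (p. 58), p. 59; Lemma 6.1 and §6.2.1 (pp. 65–67); §3.5 (p. 32)] -/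
theorem tsum_nobleXiT_le_starAvg_of_cover (n : ℕ)
    (Ec : Fin d × Bool → Fin 3 → Site d → Site d → Site d → ℝ≥0∞)
    (Eo : Fin d × Bool → Fin 3 → Site d → Site d → Site d → Site d → ℝ≥0∞)
    (Eoc : Fin d × Bool → Site d → Site d → Site d → ℝ≥0∞)
    (EA : Fin d × Bool → Fin 3 → Site d → Site d → Site d → ℝ≥0∞)
    (Ecpt : Fin d × Bool → Fin 3 → Site d → Site d → Site d → Site d → Site d → ℝ≥0∞)
    (Eopt : Fin d × Bool → Fin 3 → Site d → Site d → Site d → Site d → Site d → Site d → ℝ≥0∞)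
    (Eocpt : Fin d × Bool → Site d → Site d → Site d → Site d → Site d → ℝ≥0∞)
    (hEcpt : ∀ κ a u w u', ∑' t, ∑' z, Ecpt κ a u w t z u' ≤ Ec κ a u w u')
    (hEopt : ∀ κ a' u w w' u', ∑' t, ∑' z, Eopt κ a' u w t z w' u' ≤ Eo κ a' u w w' u')
    (hEocpt : ∀ κ u w u', ∑' t, ∑' z, Eocpt κ u w t z u' ≤ Eoc κ u w u')
    (hEc : ∀ κ a, IsTransInv₃ (Ec κ a)) (hEo : ∀ κ a', IsTransInv (Eo κ a')) (hEoc : ∀ κ, IsTransInv₃ (Eoc κ))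
    (hEA : ∀ κ c, IsTransInv₃ (EA κ c))
    (hEcc : ∀ a, IsCov₃ (signedPermAddEquivs d) (fun u w u' => ∑ κ, Ec κ a u w u'))
    (hEocv : ∀ a', IsCov₄ (signedPermAddEquivs d) (fun u w w' u' => ∑ κ, Eo κ a' u w w' u'))
    (hEocc : IsCov₃ (signedPermAddEquivs d) (fun u w u' => ∑ κ, Eoc κ u w u'))
    (hEAout : ∀ κ (v x : Site d), v - x ∉ unitVecs d → EA κ 1 0 v x = 0)
    (E : Site d → (Fin (n + 1) → Site d × Site d) → (Fin (n + 1) → Site d) → (Fin (n + 1) → Site d) →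
      (Fin (n + 1) → Site d) → Set (Fin (n + 2) → BondConfig (Site d)))
    (C : Site d → (Fin (n + 1) → Site d × Site d) → (Fin (n + 1) → Site d) → (Fin (n + 1) → Site d) →
      (Fin (n + 1) → Site d) → (Fin (n + 1) → Fin 3 ⊕ Unit) → Fin 3 ⊕ Unit → Set (Fin (n + 2) → BondConfig (Site d)))
    (hC : ∀ x b w t z, E x b w t z ⊆ ⋃ a, ⋃ c, C x b w t z a c)
    (h1 : ∀ x, nobleXiT d p (n + 1) x ≤ ∑' b : Fin (n + 1) → Site d × Site d, ∑' w : Fin (n + 1) → Site d,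
      ∑' t : Fin (n + 1) → Site d, ∑' z : Fin (n + 1) → Site d,
        (∏ i, ENNReal.ofReal (bondJ d p ((b i).2 - (b i).1))) * piPerc d p (n + 2) (E x b w t z))
    (h2 : ∀ x (a : Fin (n + 1) → Fin 3 ⊕ Unit) (c : Fin 3 ⊕ Unit) (b : Fin (n + 1) → Site d × Site d)
      (w t z : Fin (n + 1) → Site d),
      (∏ i, ENNReal.ofReal (bondJ d p ((b i).2 - (b i).1))) * piPerc d p (n + 2) (E x b w t z ∩ C x b w t z a c) ≤
        ∑ κ : Fin (n + 1) → Fin d × Bool, dirInd stepVec κ b *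
          (starS (blockPS 𝐋) (a 0) (b 0).1 (w 0) *
            chainTail (starBpt (blockBFullpt 𝐋) Ecpt Eopt Eocpt) (starA (blockAbar' 𝐋) EA) (starS (blockPE 𝐋))
              x n κ a c b w t z)) :
    ∑' x, nobleXiT d p (n + 1) x ≤
      vecP (starS (blockPS 𝐋)) ᵥ* matB (starB (blockBFull 𝐋) Ec Eo Eoc) ^ n ᵥ*
        matAbarAvg (unitVecs d) (Sum.elim (fun a : Fin 3 => decide (a = 1)) fun _ => false)
          (starA (blockAbar' 𝐋) EA) ⬝ᵥ vecP (starS (blockPE 𝐋)) :=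
  tsum_le_star_chain_avg' (unitVecs d) (fun a : Fin 3 => decide (a = 1)) (signedPermAddEquivs d)
    signedPermAddEquivs_transitive (isTransInv_blockBFull 𝐋) hEc hEo hEoc (isTransInv_blockAbar' 𝐋) hEA
    (perc_blockAbar'_hAin p) (perc_blockAbar'_hAout p)
    (fun κ c hc v x hvx => by
      obtain rfl : c = 1 := of_decide_eq_true hc
      exact hEAout κ v x hvx)
    (isCov₂_perc_blockPS p) (isCov₄_sum_perc_blockBFull p) hEcc hEocv hEocc
    (fun b _ => isConstOn_gapSum_perc_blockPE p b) (fun x => nobleXiT d p (n + 1) x) n fun x =>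
    nobleXiT_le_recP_chain_of_cover p x n (starS (blockPS 𝐋)) (starB (blockBFull 𝐋) Ec Eo Eoc)
      (starBpt (blockBFullpt 𝐋) Ecpt Eopt Eocpt) (starBpt_hBpt _ _ _ _ (blockBFullpt_hBpt 𝐋) hEcpt hEopt hEocpt)
      (starA (blockAbar' 𝐋) EA) (starS (blockPE 𝐋)) (E x) (C x) (hC x) (h1 x) (h2 x)

/-- **(5.34) at `N = n + 1` over `Fin 3 ⊕ Unit`, averaged element, SECTION choice** (`a₂ = 2`, `a₀ = 0`,
`EA = secEA (blockAbar' 𝐋) 2`): every side condition discharged by name; only the cover and the pointwise class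
estimates remain. [cite: FitznerVanDerHofstad2017, Prop. 5.5 (5.34) (arXiv:1506.07977v2 p. 53); §5.1 (5.4) (p. 48); §6.1 p. 59; Lemma 6.1 and §6.2.1 (pp. 65–67); §3.5 (p. 32)] -/
theorem tsum_nobleXiT_le_secStarAvg_of_cover (n : ℕ)
    (E : Site d → (Fin (n + 1) → Site d × Site d) → (Fin (n + 1) → Site d) → (Fin (n + 1) → Site d) →
      (Fin (n + 1) → Site d) → Set (Fin (n + 2) → BondConfig (Site d)))
    (C : Site d → (Fin (n + 1) → Site d × Site d) → (Fin (n + 1) → Site d) → (Fin (n + 1) → Site d) →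
      (Fin (n + 1) → Site d) → (Fin (n + 1) → Fin 3 ⊕ Unit) → Fin 3 ⊕ Unit → Set (Fin (n + 2) → BondConfig (Site d)))
    (hC : ∀ x b w t z, E x b w t z ⊆ ⋃ a, ⋃ c, C x b w t z a c)
    (h1 : ∀ x, nobleXiT d p (n + 1) x ≤ ∑' b : Fin (n + 1) → Site d × Site d, ∑' w : Fin (n + 1) → Site d,
      ∑' t : Fin (n + 1) → Site d, ∑' z : Fin (n + 1) → Site d,
        (∏ i, ENNReal.ofReal (bondJ d p ((b i).2 - (b i).1))) * piPerc d p (n + 2) (E x b w t z))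
    (h2 : ∀ x (a : Fin (n + 1) → Fin 3 ⊕ Unit) (c : Fin 3 ⊕ Unit) (b : Fin (n + 1) → Site d × Site d)
      (w t z : Fin (n + 1) → Site d),
      (∏ i, ENNReal.ofReal (bondJ d p ((b i).2 - (b i).1))) * piPerc d p (n + 2) (E x b w t z ∩ C x b w t z a c) ≤
        ∑ κ : Fin (n + 1) → Fin d × Bool, dirInd stepVec κ b *
          (starS (blockPS 𝐋) (a 0) (b 0).1 (w 0) *
            chainTail (secStarBpt (blockBFullpt 𝐋) 2 0) (starA (blockAbar' 𝐋) (secEA (blockAbar' 𝐋) 2))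
              (starS (blockPE 𝐋)) x n κ a c b w t z)) :
    ∑' x, nobleXiT d p (n + 1) x ≤
      vecP (starS (blockPS 𝐋)) ᵥ*
        matB (starB (blockBFull 𝐋) (secEc (blockBFullpt 𝐋) 0) (secEo (blockBFullpt 𝐋) 2) (secEoc (blockBFullpt 𝐋) 2 0)) ^ n ᵥ*
          matAbarAvg (unitVecs d) (Sum.elim (fun a : Fin 3 => decide (a = 1)) fun _ => false)
            (starA (blockAbar' 𝐋) (secEA (blockAbar' 𝐋) 2)) ⬝ᵥ vecP (starS (blockPE 𝐋)) :=
  tsum_nobleXiT_le_starAvg_of_cover p n _ _ _ _ (secEcpt (blockBFullpt 𝐋) 0) (secEopt (blockBFullpt 𝐋) 2)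
    (secEocpt (blockBFullpt 𝐋) 2 0) (fun κ a u w u' => (tsum_tsum_secEcpt (blockBFullpt 𝐋) 0 κ a u w u').le)
    (fun κ a' u w w' u' => (tsum_tsum_secEopt (blockBFullpt 𝐋) 2 κ a' u w w' u').le)
    (fun κ u w u' => (tsum_tsum_secEocpt (blockBFullpt 𝐋) 2 0 κ u w u').le)
    (isTransInv₃_secEc (isTransInv₆_blockBFullpt 𝐋) 0) (isTransInv_secEo (isTransInv₆_blockBFullpt 𝐋) 2)
    (isTransInv₃_secEoc (isTransInv₆_blockBFullpt 𝐋) 2 0) (isTransInv₃_secEA (isTransInv_blockAbar' 𝐋) 2)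
    (isCov₃_sum_secEc (isCov₆_sum_perc_blockBFullpt p) 0) (isCov₄_sum_secEo (isCov₆_sum_perc_blockBFullpt p) 2)
    (isCov₃_sum_secEoc (isCov₆_sum_perc_blockBFullpt p) 2 0)
    (fun κ v x hvx => perc_blockAbar'_hAout p κ 2 1 rfl v x v hvx) E C hC h1 h2

/-- **The size model with the averaged element, as a kernel inequality**: under the section estimates,
`Σ_x Ξ^{(n+1)}(x) ≤ (P⃗^S,0) · [[B, B_{·,0}],[B_{2,·}, B_{2,0}]]^n · [[Ā'_avg, 0],[Ā'_{2,·}, 0]] · (P⃗^E,0)`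
(`B = matB (blockBFull 𝐋)`, `Ā'_avg = matAbarAvg (unitVecs d) (· = 1) (blockAbar' 𝐋)`, `Ā' = matAbar (blockAbar' 𝐋)`).
[cite: FitznerVanDerHofstad2017, Prop. 5.5 (5.34) (arXiv:1506.07977v2 p. 53); §5.1 "Elements of the bounds" (p. 49); §6.1 p. 59; Lemma 6.1 and §6.2.1 (pp. 65–67)] -/
theorem tsum_nobleXiT_le_borderedAvg_of_cover (n : ℕ)
    (E : Site d → (Fin (n + 1) → Site d × Site d) → (Fin (n + 1) → Site d) → (Fin (n + 1) → Site d) →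
      (Fin (n + 1) → Site d) → Set (Fin (n + 2) → BondConfig (Site d)))
    (C : Site d → (Fin (n + 1) → Site d × Site d) → (Fin (n + 1) → Site d) → (Fin (n + 1) → Site d) →
      (Fin (n + 1) → Site d) → (Fin (n + 1) → Fin 3 ⊕ Unit) → Fin 3 ⊕ Unit → Set (Fin (n + 2) → BondConfig (Site d)))
    (hC : ∀ x b w t z, E x b w t z ⊆ ⋃ a, ⋃ c, C x b w t z a c)
    (h1 : ∀ x, nobleXiT d p (n + 1) x ≤ ∑' b : Fin (n + 1) → Site d × Site d, ∑' w : Fin (n + 1) → Site d,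
      ∑' t : Fin (n + 1) → Site d, ∑' z : Fin (n + 1) → Site d,
        (∏ i, ENNReal.ofReal (bondJ d p ((b i).2 - (b i).1))) * piPerc d p (n + 2) (E x b w t z))
    (h2 : ∀ x (a : Fin (n + 1) → Fin 3 ⊕ Unit) (c : Fin 3 ⊕ Unit) (b : Fin (n + 1) → Site d × Site d)
      (w t z : Fin (n + 1) → Site d),
      (∏ i, ENNReal.ofReal (bondJ d p ((b i).2 - (b i).1))) * piPerc d p (n + 2) (E x b w t z ∩ C x b w t z a c) ≤
        ∑ κ : Fin (n + 1) → Fin d × Bool, dirInd stepVec κ b *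
          (starS (blockPS 𝐋) (a 0) (b 0).1 (w 0) *
            chainTail (secStarBpt (blockBFullpt 𝐋) 2 0) (starA (blockAbar' 𝐋) (secEA (blockAbar' 𝐋) 2))
              (starS (blockPE 𝐋)) x n κ a c b w t z)) :
    ∑' x, nobleXiT d p (n + 1) x ≤
      Sum.elim (vecPS 𝐋) (0 : Unit → ℝ≥0∞) ᵥ*
        Matrix.fromBlocks (matB (blockBFull 𝐋)) (Matrix.of fun (a : Fin 3) (_ : Unit) => matB (blockBFull 𝐋) a 0)
          (Matrix.of fun (_ : Unit) (a' : Fin 3) => matB (blockBFull 𝐋) 2 a')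
          (Matrix.of fun (_ : Unit) (_ : Unit) => matB (blockBFull 𝐋) 2 0) ^ n ᵥ*
        Matrix.fromBlocks (matAbarAvg (unitVecs d) (fun a : Fin 3 => decide (a = 1)) (blockAbar' 𝐋))
          (0 : Matrix (Fin 3) Unit ℝ≥0∞) (Matrix.of fun (_ : Unit) (c : Fin 3) => matAbar (blockAbar' 𝐋) 2 c)
          (0 : Matrix Unit Unit ℝ≥0∞) ⬝ᵥ
          Sum.elim (vecPE 𝐋) (0 : Unit → ℝ≥0∞) := by
  refine (tsum_nobleXiT_le_secStarAvg_of_cover p n E C hC h1 h2).trans ?_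
  rw [vecP_starS, vecP_starS]
  exact star_chain_mono (fun i => le_rfl) (matB_starB_sec_le (blockBFullpt_hBpt 𝐋) 2 0)
    (matAbarAvg_starA_sec_le (unitVecs d) (fun a : Fin 3 => decide (a = 1)) (blockAbar' 𝐋) 2) (fun i => le_rfl) n

end Perc

end Literature.Probability.FitznerVanDerHofstad2017

end
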